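import Mathlib.Analysis.InnerProductSpace.LinearMap
import Mathlib.Analysis.Normed.Algebra.Spectrum
import Mathlib.LinearAlgebra.Matrix.NonsingularInverse
import Mathlib.LinearAlgebra.Matrix.ToLinearEquiv
import Mathlib.LinearAlgebra.Eigenspace.Basic
import Mathlib.Tactic.Module
import Mathlib.Tactic.LinearCombination
import HarnessLib

/-!
# Finite-rank (separable) perturbations: the T-matrix, the Weinstein–Aronszajn determinant,
# and Faddeev's resummation

Topic `Literature/MathematicalPhysics/KineticTheory` (definition request `defn-SeparableTwoBodyTMatrix`,
wanted by crux MourreDissolution `stmt-AtomisticToContinuum-12594`, line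
`separable-vertex-faddeev-pair-sector`: per total-momentum fibre the resummed first-order pair sector of the
anharmonic Liouvillian is "a band `E_K(p)` as a multiplication operator on `L²(𝕋)` + `λ·`(rank `≤ 2`
separable operator `Σ_{i<2} |u_i⟩⟨v_i|`)"). This file is the ABSTRACT part over Mathlib — everything that
does not depend on the band being a multiplication operator; the multiplication-operator / pinned-band
instance, the threshold behaviour at a one-dimensional band edge and the `(2,2)`-shell pair coordinates are
in `SeparablePairBand.lean`.

## The objects (all with bodies) and what is PROVED

Let `H` be a complex inner-product space, `M : H →L[ℂ] H` (the unperturbed operator; no self-adjointness is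
used), `ι` a finite index type (the rank; `Fin r` for the requester), `u v : ι → H` the FORM FACTORS and
`λ : ℂ` the coupling. Mathlib's `resolvent M z = (z − M)⁻¹` (`Ring.inverse`, junk `0` on the spectrum) and
`resolventSet ℂ M` are used throughout.

* §1 `synth u c = Σ c_i u_i` (`U : ℂ^ι → H`), `coeffs v x = (⟪v_i, x⟫)_i` (`V* : H → ℂ^ι`),
  `separableOp u v = Σ |u_i⟩⟨v_i| = U V*`, the dressed operator `dressedOp u v A = U A V*`
  (`A : Matrix ι ι ℂ`), and `perturb M λ u v = H_λ = M + λ Σ |u_i⟩⟨v_i|`.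
* §2 the `ι × ι` matrix `gMatrix M u v z = g(z)`, `g(z)_{ij} = ⟪v_i, (z − M)⁻¹ u_j⟫` (`= V*(z − M)⁻¹U`,
  `coeffs_resolvent_synth`); the FREDHOLM / WEINSTEIN–ARONSZAJN DETERMINANT
  `fredholmDet M λ u v z = det(1 − λ g(z))` — Kato's W–A determinant of the first kind
  `ω(z; M, A) = det(1 + A(M − z)⁻¹)`, `A = λUV*`, written through the matrix `(δ_jk + ((M − z)⁻¹x_j, e_k))`
  [Kato1966, Ch. IV §6.1 eqs. (6.1)–(6.4)] (here `(M − z)⁻¹ = −(z − M)⁻¹` absorbs the sign); the T-MATRIX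
  `tMatrix M λ u v z = τ(z) = (1 − λ g(z))⁻¹` (`Matrix.inv`, junk when `det = 0`) and the T-OPERATOR
  `tOperator M λ u v z = T(z) = λ U τ(z) V*`.
* §3 PROVED — the finite-rank Birman–Schwinger / W–A principle: for `z ∈ ρ(M)`,
  `z` is an eigenvalue of `H_λ` iff `det(1 − λ g(z)) = 0` (`hasEigenvector_perturb_iff`), the eigenvectors
  being exactly `ψ = (z − M)⁻¹ U c` with `(1 − λ g(z)) c = 0` [Kato1966, Ch. IV §6.2 Thm 6.2 (first W–A
  formula), the zero-order part; Economou1983 §6.1 eq. (6.9) for rank one].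
* §4 PROVED — the T-MATRIX IDENTITY (second resolvent identity summed in closed form; Sherman–Morrison–
  Woodbury): for `z ∈ ρ(M)` with `det(1 − λ g(z)) ≠ 0`, `z ∈ ρ(H_λ)` and
  `(z − H_λ)⁻¹ = (z − M)⁻¹ + (z − M)⁻¹ T(z) (z − M)⁻¹`, `T(z) = λU(1 − λg(z))⁻¹V*`
  (`resolvent_perturb`), so that `ρ(M) ∩ σ(H_λ) = {det(1 − λ g) = 0} =` eigenvalues
  (`mem_resolventSet_perturb_iff`, `mem_spectrum_perturb_iff`) [Economou1983, §6.1 eqs. (6.6)–(6.9)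
  (`G = G₀ + G₀TG₀`, `T = |ℓ⟩ ε/(1 − εG₀(ℓ,ℓ)) ⟨ℓ|`); Kato1966, Ch. IV §6]; and T satisfies the
  Lippmann–Schwinger equation `T = λS + λS(z − M)⁻¹T` (`tOperator_lippmannSchwinger`).
* §5 rank one: `perturb₁ M λ u v = M + λ|u⟩⟨v|`, eigenvalue iff `λ⟪v, (z − M)⁻¹u⟫ = 1`
  (`hasEigenvector_perturb₁_iff`) [Economou1983, §6.1 eq. (6.9)].
* §6 FADDEEV'S RESUMMATION for finitely many channels `H = H₀ + λ Σ_α V_α` (statement-level definitions +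
  the algebraic theorem): the channel T-operators `t_α = λV_α + λV_α R₀ t_α` (`IsChannelTOperator`), the
  FADDEEV SYSTEM for the components `F_α = t_α + t_α R₀ Σ_{β ≠ α} F_β` (`IsFaddeevSolution`), and PROVED:
  a solution of the Faddeev system resums to the full T-operator, `T := Σ_α F_α = λV + λV R₀ T`, hence
  `(z − H)(R₀ + R₀ T R₀) = 1` (`IsFaddeevSolution.lippmannSchwinger`, `IsFaddeevSolution.rightInverse`)
  [Faddeev1961; DreizlerKirchnerLudde2018, §7.5 eqs. (7.30)–(7.37)]. With separable channels the `t_α` are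
  the explicit `tOperator`s of §2 (`tOperator_lippmannSchwinger`), which is what turns the system into
  one-variable integral equations on the `(2,2)` shell (the fibred instance: `SeparablePairBand.lean`).

## Conventions / junk values

* `⟪·,·⟫` is Mathlib's (conjugate-linear in the FIRST slot), so `|u⟩⟨v| x = ⟪v, x⟫ u`.
* `resolvent M z = (z − M)⁻¹` (Mathlib; `0` on the spectrum); `tMatrix` is `Matrix.inv` (junk unless
  `fredholmDet ≠ 0`); every theorem that needs invertibility says so.
* `λ : ℂ` (the physics has `λ : ℝ`; cast). No self-adjointness, no completeness of `H` is assumed in this file.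

## What is NOT here

* No analytic dependence on `z` (meromorphy of `ω`), no multiplicity count beyond "eigenvector iff
  `ker(1 − λg) ≠ 0`" (Kato's full W–A formula counts algebraic multiplicities by the order of the zero).
* No trace-class / infinite-rank Fredholm determinants (Simon, Trace ideals) — finite rank suffices for the
  requester's rank `≤ 2` fibres.
* The multiplication-operator instance, thresholds and the `(2,2)`-shell coordinates: `SeparablePairBand.lean`.

## References

* T. Kato, Perturbation Theory for Linear Operators, Springer 1966, Ch. IV §6.1–6.2 (degenerate
  perturbations, W–A determinants (6.1)–(6.4), Thm 6.2). [cite: Kato1966, Ch. IV §6 eqs. (6.1)–(6.4), Thm 6.2]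
* E. N. Economou, Green's Functions in Quantum Physics, 2nd ed., Springer Series in Solid-State Sciences 7,
  1983, §6.1 (single impurity: `T = |ℓ⟩ε(1 − εG₀(ℓ,ℓ))⁻¹⟨ℓ|`, `G = G₀ + G₀TG₀`, poles `G₀(ℓ,ℓ;E_p) = 1/ε`).
  [cite: Economou1983, §6.1 eqs. (6.6)–(6.9)]
* L. D. Faddeev, Scattering theory for a three-particle system, Sov. Phys. JETP 12 (1961) 1014–1019.
  [cite: Faddeev1961]
* R. M. Dreizler, T. Kirchner, C. S. Lüdde, Streutheorie in der nichtrelativistischen Quantenmechanik,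
  Springer 2018, §7.5 (7.30)–(7.37) (two-body T-operators in the three-body space, Faddeev equations).
  [cite: DreizlerKirchnerLudde2018, §7.5 eqs. (7.30)–(7.37)]
-/

noncomputable section

open scoped InnerProductSpace ComplexConjugate Matrix

namespace Literature.MathematicalPhysics.KineticTheory

namespace FiniteRank

variable {H : Type*} [NormedAddCommGroup H] [InnerProductSpace ℂ H]
variable {ι : Type*}

/-! ## §1. Synthesis, analysis, separable operators, the perturbed operator -/

/-- The ANALYSIS map of the form factors `v`: `(V* x)_i = ⟪v_i, x⟫` (linear in `x`). [folklore] -/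
def coeffs (v : ι → H) (x : H) : ι → ℂ := fun i => ⟪v i, x⟫_ℂ

/-- `coeffs v x i = ⟪v i, x⟫`. [folklore] -/
@[simp] theorem coeffs_apply (v : ι → H) (x : H) (i : ι) : coeffs v x i = ⟪v i, x⟫_ℂ := rfl

/-- `V* 0 = 0`. [folklore] -/
@[simp] theorem coeffs_zero (v : ι → H) : coeffs v (0 : H) = 0 := by
  funext i; simp [coeffs]

/-- `V*` is additive. [folklore] -/
theorem coeffs_add (v : ι → H) (x y : H) : coeffs v (x + y) = coeffs v x + coeffs v y := by
  funext i; simp [coeffs, inner_add_right]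

/-- `V*` is homogeneous. [folklore] -/
theorem coeffs_smul (v : ι → H) (a : ℂ) (x : H) : coeffs v (a • x) = a • coeffs v x := by
  funext i; simp [coeffs, inner_smul_right]

/-- `V*` respects subtraction. [folklore] -/
theorem coeffs_sub (v : ι → H) (x y : H) : coeffs v (x - y) = coeffs v x - coeffs v y := by
  funext i; simp [coeffs, inner_sub_right]

variable [Fintype ι]

/-- The SYNTHESIS map of the form factors `u`: `U c = Σ_i c_i u_i`. [folklore] -/
def synth (u : ι → H) (c : ι → ℂ) : H := ∑ i, c i • u i

/-- `U 0 = 0`. [folklore] -/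
@[simp] theorem synth_zero (u : ι → H) : synth u 0 = 0 := by simp [synth]

/-- `U` is additive. [folklore] -/
theorem synth_add (u : ι → H) (c d : ι → ℂ) : synth u (c + d) = synth u c + synth u d := by
  simp [synth, add_smul, Finset.sum_add_distrib]

/-- `U` is homogeneous. [folklore] -/
theorem synth_smul (u : ι → H) (a : ℂ) (c : ι → ℂ) : synth u (a • c) = a • synth u c := by
  simp [synth, Finset.smul_sum, smul_smul]

/-- `U` respects subtraction. [folklore] -/
theorem synth_sub (u : ι → H) (c d : ι → ℂ) : synth u (c - d) = synth u c - synth u d := by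
  simp [synth, sub_smul, Finset.sum_sub_distrib]

/-- **`V* R U` is the matrix `(⟪v_i, R u_j⟫)`**: `coeffs v (R (U c)) = (⟪v_i, R u_j⟫)_{ij} *ᵥ c` for any
bounded `R`. [folklore] -/
theorem coeffs_map_synth (v u : ι → H) (R : H →L[ℂ] H) (c : ι → ℂ) :
    coeffs v (R (synth u c)) = (Matrix.of fun i j => ⟪v i, R (u j)⟫_ℂ) *ᵥ c := by
  funext i
  simp only [coeffs, synth, map_sum, map_smul, inner_sum, inner_smul_right, Matrix.mulVec,
    dotProduct, Matrix.of_apply]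
  exact Finset.sum_congr rfl fun j _ => mul_comm _ _

/-- The DRESSED SEPARABLE OPERATOR `U A V* : x ↦ Σ_i (Σ_j A_{ij} ⟪v_j, x⟫) u_i` for a matrix `A`
(`A = 1`: the bare `Σ|u_i⟩⟨v_i|`; `A = τ(z)`: the T-operator up to `λ`). [folklore] -/
def dressedOp (u v : ι → H) (A : Matrix ι ι ℂ) : H →L[ℂ] H :=
  ∑ i, ∑ j, A i j • (innerSL ℂ (v j)).smulRight (u i)

/-- `U A V* x = U (A *ᵥ V* x)`. [folklore] -/
theorem dressedOp_apply (u v : ι → H) (A : Matrix ι ι ℂ) (x : H) :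
    dressedOp u v A x = synth u (A *ᵥ coeffs v x) := by
  simp only [dressedOp, sum_apply, smul_apply, ContinuousLinearMap.smulRight_apply,
    innerSL_apply_apply, synth, Matrix.mulVec, dotProduct, coeffs, Finset.sum_smul, smul_smul]

/-- The SEPARABLE (finite-rank) OPERATOR `Σ_i |u_i⟩⟨v_i| = U V*`. [cite: Kato1966, Ch. IV §6 eq. (6.2)] -/
def separableOp (u v : ι → H) : H →L[ℂ] H := ∑ i, (innerSL ℂ (v i)).smulRight (u i)

/-- `Σ|u_i⟩⟨v_i| x = U (V* x) = Σ ⟪v_i, x⟫ u_i`. [folklore] -/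
theorem separableOp_apply (u v : ι → H) (x : H) : separableOp u v x = synth u (coeffs v x) := by
  simp only [separableOp, sum_apply, ContinuousLinearMap.smulRight_apply, innerSL_apply_apply, synth,
    coeffs]

/-- `Σ|u_i⟩⟨v_i| = U 1 V*`. [folklore] -/
theorem separableOp_eq_dressedOp_one [DecidableEq ι] (u v : ι → H) :
    separableOp u v = dressedOp u v 1 := by
  ext x
  rw [separableOp_apply, dressedOp_apply, Matrix.one_mulVec]

/-- **The finite-rank perturbation `H_λ = M + λ Σ_i |u_i⟩⟨v_i|`** of a bounded operator `M`.
[cite: Kato1966, Ch. IV §6 eqs. (6.1)–(6.2)] -/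
def perturb (M : H →L[ℂ] H) (lam : ℂ) (u v : ι → H) : H →L[ℂ] H := M + lam • separableOp u v

/-- `H_λ x = M x + λ U V* x`. [folklore] -/
theorem perturb_apply (M : H →L[ℂ] H) (lam : ℂ) (u v : ι → H) (x : H) :
    perturb M lam u v x = M x + lam • synth u (coeffs v x) := by
  simp only [perturb, add_apply, smul_apply, separableOp_apply]

/-! ## §2. The resolvent of `M`, the matrix `g(z)`, the W–A determinant, the T-matrix -/

section Resolvent

variable (M : H →L[ℂ] H) (z : ℂ)

/-- `resolvent M z = (z•1 − M)⁻¹` (Mathlib's definition, unfolded). [folklore] -/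
theorem resolvent_eq_inverse : resolvent M z = Ring.inverse (z • (1 : H →L[ℂ] H) - M) := by
  rw [resolvent, Algebra.algebraMap_eq_smul_one]

/-- `z ∈ ρ(M)` iff `z•1 − M` is a unit. [folklore] -/
theorem mem_resolventSet_iff' : z ∈ resolventSet ℂ M ↔ IsUnit (z • (1 : H →L[ℂ] H) - M) := by
  rw [spectrum.mem_resolventSet_iff, Algebra.algebraMap_eq_smul_one]

variable {M z}

/-- `(z − M)(z − M)⁻¹ = 1` on `ρ(M)`. [folklore] -/
theorem sub_mul_resolvent (hz : z ∈ resolventSet ℂ M) : (z • 1 - M) * resolvent M z = 1 := by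
  rw [resolvent_eq_inverse]
  exact Ring.mul_inverse_cancel _ ((mem_resolventSet_iff' M z).mp hz)

/-- `(z − M)⁻¹(z − M) = 1` on `ρ(M)`. [folklore] -/
theorem resolvent_mul_sub (hz : z ∈ resolventSet ℂ M) : resolvent M z * (z • 1 - M) = 1 := by
  rw [resolvent_eq_inverse]
  exact Ring.inverse_mul_cancel _ ((mem_resolventSet_iff' M z).mp hz)

/-- Pointwise: `z R₀x − M R₀x = x`. [folklore] -/
theorem sub_resolvent_apply (hz : z ∈ resolventSet ℂ M) (x : H) :
    z • resolvent M z x - M (resolvent M z x) = x := by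
  have h := congrArg (fun T : H →L[ℂ] H => T x) (sub_mul_resolvent hz)
  simpa only [mul_apply_eq_comp, sub_apply, smul_apply, one_apply_eq_self] using h

/-- Pointwise: `R₀(z x − M x) = x`. [folklore] -/
theorem resolvent_sub_apply (hz : z ∈ resolventSet ℂ M) (x : H) :
    resolvent M z (z • x - M x) = x := by
  have h := congrArg (fun T : H →L[ℂ] H => T x) (resolvent_mul_sub hz)
  simpa only [mul_apply_eq_comp, sub_apply, smul_apply, one_apply_eq_self] using h

end Resolvent

/-- **The matrix `g(z)_{ij} = ⟪v_i, (z − M)⁻¹ u_j⟫ = (V*(z − M)⁻¹U)_{ij}`** (Kato's `((T − ζ)⁻¹x_j, e_k)` up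
to the sign of the resolvent; Economou's `G₀(ℓ,ℓ;E)` for rank one). [cite: Kato1966, Ch. IV §6 eq. (6.4)] -/
def gMatrix (M : H →L[ℂ] H) (u v : ι → H) (z : ℂ) : Matrix ι ι ℂ :=
  Matrix.of fun i j => ⟪v i, resolvent M z (u j)⟫_ℂ

omit [Fintype ι] in
/-- Entries of `g(z)`. [folklore] -/
@[simp] theorem gMatrix_apply (M : H →L[ℂ] H) (u v : ι → H) (z : ℂ) (i j : ι) :
    gMatrix M u v z i j = ⟪v i, resolvent M z (u j)⟫_ℂ := rfl

/-- `V*(z − M)⁻¹U c = g(z) c`. [folklore] -/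
theorem coeffs_resolvent_synth (M : H →L[ℂ] H) (u v : ι → H) (z : ℂ) (c : ι → ℂ) :
    coeffs v (resolvent M z (synth u c)) = gMatrix M u v z *ᵥ c :=
  coeffs_map_synth v u (resolvent M z) c

variable [DecidableEq ι]

/-- **The Fredholm / Weinstein–Aronszajn determinant `d(z) = det(1 − λ g(z))`** of the finite-rank
perturbation `H_λ = M + λUV*` at `z ∈ ρ(M)` (Kato's `ω(z; M, λUV*) = det(1 + λUV*(M − z)⁻¹)`, reduced to the
`ι × ι` matrix by (6.3)–(6.4)). [cite: Kato1966, Ch. IV §6 eqs. (6.1)–(6.4)] -/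
def fredholmDet (M : H →L[ℂ] H) (lam : ℂ) (u v : ι → H) (z : ℂ) : ℂ :=
  (1 - lam • gMatrix M u v z).det

/-- **The T-MATRIX `τ(z) = (1 − λ g(z))⁻¹`** (`Matrix.inv`; meaningful iff `fredholmDet ≠ 0`).
[cite: Economou1983, §6.1 eq. (6.6)] -/
def tMatrix (M : H →L[ℂ] H) (lam : ℂ) (u v : ι → H) (z : ℂ) : Matrix ι ι ℂ :=
  (1 - lam • gMatrix M u v z)⁻¹

/-- **The T-OPERATOR `T(z) = λ U τ(z) V* = λ Σ_{ij} τ(z)_{ij} |u_i⟩⟨v_j|`** of the finite-rank perturbation.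
[cite: Economou1983, §6.1 eqs. (6.6)–(6.8)] -/
def tOperator (M : H →L[ℂ] H) (lam : ℂ) (u v : ι → H) (z : ℂ) : H →L[ℂ] H :=
  lam • dressedOp u v (tMatrix M lam u v z)

/-- `T(z) x = λ U (τ(z) V* x)`. [folklore] -/
theorem tOperator_apply (M : H →L[ℂ] H) (lam : ℂ) (u v : ι → H) (z : ℂ) (x : H) :
    tOperator M lam u v z x = lam • synth u (tMatrix M lam u v z *ᵥ coeffs v x) := by
  rw [tOperator, smul_apply, dressedOp_apply]

/-- `(1 − λg) τ = 1` when `d(z) ≠ 0`. [folklore] -/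
theorem one_sub_mul_tMatrix {M : H →L[ℂ] H} {lam : ℂ} {u v : ι → H} {z : ℂ}
    (hd : fredholmDet M lam u v z ≠ 0) :
    (1 - lam • gMatrix M u v z) * tMatrix M lam u v z = 1 :=
  Matrix.mul_nonsing_inv _ (isUnit_iff_ne_zero.mpr hd)

/-- `τ (1 − λg) = 1` when `d(z) ≠ 0`. [folklore] -/
theorem tMatrix_mul_one_sub {M : H →L[ℂ] H} {lam : ℂ} {u v : ι → H} {z : ℂ}
    (hd : fredholmDet M lam u v z ≠ 0) :
    tMatrix M lam u v z * (1 - lam • gMatrix M u v z) = 1 :=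
  Matrix.nonsing_inv_mul _ (isUnit_iff_ne_zero.mpr hd)

/-- `τ c − λ g (τ c) = c` (vector form of `(1 − λg)τ = 1`). [folklore] -/
theorem tMatrix_mulVec_sub {M : H →L[ℂ] H} {lam : ℂ} {u v : ι → H} {z : ℂ}
    (hd : fredholmDet M lam u v z ≠ 0) (c : ι → ℂ) :
    tMatrix M lam u v z *ᵥ c - lam • (gMatrix M u v z *ᵥ (tMatrix M lam u v z *ᵥ c)) = c := by
  have h := congrArg (fun A : Matrix ι ι ℂ => A *ᵥ c) (one_sub_mul_tMatrix hd)
  simpa only [← Matrix.mulVec_mulVec, Matrix.sub_mulVec, Matrix.one_mulVec,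
    Matrix.smul_mulVec] using h

/-- `τ (c − λ g c) = c` (vector form of `τ(1 − λg) = 1`). [folklore] -/
theorem tMatrix_mulVec_sub' {M : H →L[ℂ] H} {lam : ℂ} {u v : ι → H} {z : ℂ}
    (hd : fredholmDet M lam u v z ≠ 0) (c : ι → ℂ) :
    tMatrix M lam u v z *ᵥ c - lam • (tMatrix M lam u v z *ᵥ (gMatrix M u v z *ᵥ c)) = c := by
  have h := congrArg (fun A : Matrix ι ι ℂ => A *ᵥ c) (tMatrix_mul_one_sub hd)
  simpa only [← Matrix.mulVec_mulVec, Matrix.sub_mulVec, Matrix.one_mulVec, Matrix.smul_mulVec,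
    Matrix.mulVec_sub, Matrix.mulVec_smul] using h

/-! ## §3. Eigenvalues off `σ(M)`: the finite-rank Birman–Schwinger / Weinstein–Aronszajn principle -/

omit [DecidableEq ι] in
/-- An eigenvector of `H_λ` at `z ∈ ρ(M)` is `λ R₀(z) U (V*ψ)`. [cite: Kato1966, Ch. IV §6.3] -/
theorem eigenvector_eq_resolvent_synth {M : H →L[ℂ] H} {lam : ℂ} {u v : ι → H} {z : ℂ}
    (hz : z ∈ resolventSet ℂ M) {ψ : H} (hψ : perturb M lam u v ψ = z • ψ) :
    ψ = lam • resolvent M z (synth u (coeffs v ψ)) := by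
  have h1 : z • ψ - M ψ = lam • synth u (coeffs v ψ) := by
    rw [← hψ, perturb_apply]; abel
  have h2 := resolvent_sub_apply hz ψ
  rw [h1, map_smul] at h2
  exact h2.symm

omit [DecidableEq ι] in
/-- The coefficient vector `c = V*ψ` of an eigenvector at `z ∈ ρ(M)` solves `(1 − λ g(z)) c = 0`, i.e.
`c = λ g(z) c`. [cite: Kato1966, Ch. IV §6.3] -/
theorem coeffs_eigenvector_eq {M : H →L[ℂ] H} {lam : ℂ} {u v : ι → H} {z : ℂ}
    (hz : z ∈ resolventSet ℂ M) {ψ : H} (hψ : perturb M lam u v ψ = z • ψ) :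
    coeffs v ψ = lam • (gMatrix M u v z *ᵥ coeffs v ψ) := by
  conv_lhs => rw [eigenvector_eq_resolvent_synth hz hψ]
  rw [coeffs_smul, coeffs_resolvent_synth]

omit [DecidableEq ι] in
/-- Conversely, `c = λ g(z) c` makes `ψ = R₀(z) U c` an eigenvector: `H_λ ψ = z ψ`, with `V*ψ = g c`.
[cite: Kato1966, Ch. IV §6.3] -/
theorem perturb_resolvent_synth_of_eq {M : H →L[ℂ] H} {lam : ℂ} {u v : ι → H} {z : ℂ}
    (hz : z ∈ resolventSet ℂ M) {c : ι → ℂ} (hc : c = lam • (gMatrix M u v z *ᵥ c)) :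
    perturb M lam u v (resolvent M z (synth u c)) = z • resolvent M z (synth u c) := by
  set ψ := resolvent M z (synth u c) with hψ
  have hV : coeffs v ψ = gMatrix M u v z *ᵥ c := coeffs_resolvent_synth M u v z c
  have hA : z • ψ - M ψ = synth u c := sub_resolvent_apply hz _
  rw [perturb_apply, hV, ← synth_smul, ← hc, ← hA]
  abel

/-- **Finite-rank Birman–Schwinger / Weinstein–Aronszajn principle.** For `z` in the resolvent set of `M`,
`z` is an eigenvalue of `H_λ = M + λ Σ|u_i⟩⟨v_i|` iff the W–A determinant vanishes: `det(1 − λ g(z)) = 0`.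
[cite: Kato1966, Ch. IV §6.2 Thm 6.2] -/
theorem hasEigenvector_perturb_iff {M : H →L[ℂ] H} {lam : ℂ} {u v : ι → H} {z : ℂ}
    (hz : z ∈ resolventSet ℂ M) :
    (∃ ψ : H, ψ ≠ 0 ∧ perturb M lam u v ψ = z • ψ) ↔ fredholmDet M lam u v z = 0 := by
  rw [fredholmDet, ← Matrix.exists_mulVec_eq_zero_iff]
  constructor
  · rintro ⟨ψ, hψ0, hψ⟩
    refine ⟨coeffs v ψ, fun hc => hψ0 ?_, ?_⟩
    · rw [eigenvector_eq_resolvent_synth hz hψ, hc, synth_zero, map_zero, smul_zero]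
    · rw [Matrix.sub_mulVec, Matrix.one_mulVec, Matrix.smul_mulVec,
        ← coeffs_eigenvector_eq hz hψ, sub_self]
  · rintro ⟨c, hc0, hc⟩
    have hc' : c = lam • (gMatrix M u v z *ᵥ c) := by
      rw [Matrix.sub_mulVec, Matrix.one_mulVec, Matrix.smul_mulVec, sub_eq_zero] at hc
      exact hc
    refine ⟨resolvent M z (synth u c), fun h0 => hc0 ?_, perturb_resolvent_synth_of_eq hz hc'⟩
    have hV : coeffs v (resolvent M z (synth u c)) = gMatrix M u v z *ᵥ c :=
      coeffs_resolvent_synth M u v z c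
    rw [h0, coeffs_zero] at hV
    rw [hc', ← hV, smul_zero]

/-- The same, phrased with Mathlib's `Module.End.HasEigenvalue` for the underlying linear map.
[cite: Kato1966, Ch. IV §6.2 Thm 6.2] -/
theorem hasEigenvalue_perturb_iff {M : H →L[ℂ] H} {lam : ℂ} {u v : ι → H} {z : ℂ}
    (hz : z ∈ resolventSet ℂ M) :
    Module.End.HasEigenvalue (perturb M lam u v : H →ₗ[ℂ] H) z ↔ fredholmDet M lam u v z = 0 := by
  rw [← hasEigenvector_perturb_iff hz, Module.End.hasEigenvalue_iff, Submodule.ne_bot_iff]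
  simp only [Module.End.mem_eigenspace_iff, ContinuousLinearMap.coe_coe]
  exact ⟨fun ⟨ψ, h, h0⟩ => ⟨ψ, h0, h⟩, fun ⟨ψ, h0, h⟩ => ⟨ψ, h, h0⟩⟩

/-! ## §4. The T-matrix identity (Woodbury) and the spectrum of `H_λ` off `σ(M)` -/

/-- **T-matrix identity, right inverse**: `(z − H_λ)(R₀ + R₀ T R₀) x = x` for `z ∈ ρ(M)`, `d(z) ≠ 0`.
[cite: Economou1983, §6.1 eq. (6.8)] -/
theorem sub_perturb_apply_woodbury {M : H →L[ℂ] H} {lam : ℂ} {u v : ι → H} {z : ℂ}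
    (hz : z ∈ resolventSet ℂ M) (hd : fredholmDet M lam u v z ≠ 0) (x : H) :
    (z • (1 : H →L[ℂ] H) - perturb M lam u v)
        ((resolvent M z + resolvent M z ∘L tOperator M lam u v z ∘L resolvent M z) x) = x := by
  -- names: y = R₀x, c = V*y, w = R₀ U τ c
  have hRx : (resolvent M z + resolvent M z ∘L tOperator M lam u v z ∘L resolvent M z) x =
      resolvent M z x + lam • resolvent M z (synth u
        (tMatrix M lam u v z *ᵥ coeffs v (resolvent M z x))) := by
    rw [add_apply, ContinuousLinearMap.comp_apply, ContinuousLinearMap.comp_apply, tOperator_apply,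
      map_smul]
  rw [hRx]
  set y := resolvent M z x with hy
  set c := coeffs v y with hc
  set w := resolvent M z (synth u (tMatrix M lam u v z *ᵥ c)) with hw
  have h1 : z • y - M y = x := sub_resolvent_apply hz x
  have h2 : z • w - M w = synth u (tMatrix M lam u v z *ᵥ c) := sub_resolvent_apply hz _
  have h3 : coeffs v w = gMatrix M u v z *ᵥ (tMatrix M lam u v z *ᵥ c) :=
    coeffs_resolvent_synth M u v z _
  have key : synth u (tMatrix M lam u v z *ᵥ c) - synth u c -
      lam • synth u (gMatrix M u v z *ᵥ (tMatrix M lam u v z *ᵥ c)) = 0 := by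
    rw [← synth_sub, ← synth_smul, ← synth_sub, sub_right_comm, tMatrix_mulVec_sub hd, sub_self,
      synth_zero]
  have hL : (z • (1 : H →L[ℂ] H) - perturb M lam u v) (y + lam • w) =
      z • (y + lam • w) - (M y + lam • M w + lam • (synth u c +
        lam • synth u (gMatrix M u v z *ᵥ (tMatrix M lam u v z *ᵥ c)))) := by
    rw [sub_apply, smul_apply, one_apply_eq_self, perturb_apply, map_add, map_smul, coeffs_add,
      coeffs_smul, h3, synth_add, synth_smul]
  rw [hL]
  linear_combination (norm := module) h1 + lam • h2 + lam • key

/-- **T-matrix identity, left inverse**: `(R₀ + R₀ T R₀)(z − H_λ) x = x` for `z ∈ ρ(M)`, `d(z) ≠ 0`.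
[cite: Economou1983, §6.1 eq. (6.8)] -/
theorem woodbury_apply_sub_perturb {M : H →L[ℂ] H} {lam : ℂ} {u v : ι → H} {z : ℂ}
    (hz : z ∈ resolventSet ℂ M) (hd : fredholmDet M lam u v z ≠ 0) (x : H) :
    (resolvent M z + resolvent M z ∘L tOperator M lam u v z ∘L resolvent M z)
        ((z • (1 : H →L[ℂ] H) - perturb M lam u v) x) = x := by
  -- names: c = V*x, p = R₀ U c
  set c := coeffs v x with hc
  set p := resolvent M z (synth u c) with hp
  have h1 : resolvent M z (z • x - M x) = x := resolvent_sub_apply hz x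
  have h3 : coeffs v p = gMatrix M u v z *ᵥ c := coeffs_resolvent_synth M u v z _
  have hw : (z • (1 : H →L[ℂ] H) - perturb M lam u v) x = (z • x - M x) - lam • synth u c := by
    rw [sub_apply, smul_apply, one_apply_eq_self, perturb_apply]; abel
  have hR1 : resolvent M z ((z • x - M x) - lam • synth u c) = x - lam • p := by
    rw [map_sub, map_smul, h1]
  have hτ : tMatrix M lam u v z *ᵥ coeffs v (x - lam • p) = c := by
    rw [coeffs_sub, coeffs_smul, h3, Matrix.mulVec_sub, Matrix.mulVec_smul]
    exact tMatrix_mulVec_sub' hd c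
  have hT : tOperator M lam u v z (x - lam • p) = lam • synth u c := by
    rw [tOperator_apply, hτ]
  rw [add_apply, ContinuousLinearMap.comp_apply, ContinuousLinearMap.comp_apply, hw, hR1, hT, map_smul,
    ← hp]
  abel

/-- **THE T-MATRIX IDENTITY** (Sherman–Morrison–Woodbury / second resolvent identity in closed form). For
`z ∈ ρ(M)` with `det(1 − λ g(z)) ≠ 0`: `z ∈ ρ(H_λ)` and
`(z − H_λ)⁻¹ = (z − M)⁻¹ + (z − M)⁻¹ T(z) (z − M)⁻¹`, `T(z) = λ U (1 − λ g(z))⁻¹ V*`.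
[cite: Economou1983, §6.1 eqs. (6.6)–(6.8)] -/
theorem resolvent_perturb {M : H →L[ℂ] H} {lam : ℂ} {u v : ι → H} {z : ℂ}
    (hz : z ∈ resolventSet ℂ M) (hd : fredholmDet M lam u v z ≠ 0) :
    z ∈ resolventSet ℂ (perturb M lam u v) ∧
      resolvent (perturb M lam u v) z =
        resolvent M z + resolvent M z ∘L tOperator M lam u v z ∘L resolvent M z := by
  set W := resolvent M z + resolvent M z ∘L tOperator M lam u v z ∘L resolvent M z
  have hr : (z • (1 : H →L[ℂ] H) - perturb M lam u v) * W = 1 :=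
    ContinuousLinearMap.ext fun x => sub_perturb_apply_woodbury hz hd x
  have hl : W * (z • (1 : H →L[ℂ] H) - perturb M lam u v) = 1 :=
    ContinuousLinearMap.ext fun x => woodbury_apply_sub_perturb hz hd x
  have hr' : (algebraMap ℂ (H →L[ℂ] H) z - perturb M lam u v) * W = 1 := by
    rwa [Algebra.algebraMap_eq_smul_one]
  have hl' : W * (algebraMap ℂ (H →L[ℂ] H) z - perturb M lam u v) = 1 := by
    rwa [Algebra.algebraMap_eq_smul_one]
  refine ⟨spectrum.mem_resolventSet_of_left_right_inverse hr' hl', ?_⟩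
  let U : (H →L[ℂ] H)ˣ := ⟨algebraMap ℂ (H →L[ℂ] H) z - perturb M lam u v, W, hr', hl'⟩
  change Ring.inverse (U : H →L[ℂ] H) = W
  rw [Ring.inverse_unit]
  rfl

/-- For `z ∈ ρ(M)`: `z ∈ ρ(H_λ)` iff `det(1 − λ g(z)) ≠ 0`. [cite: Kato1966, Ch. IV §6.2 Thm 6.2] -/
theorem mem_resolventSet_perturb_iff {M : H →L[ℂ] H} {lam : ℂ} {u v : ι → H} {z : ℂ}
    (hz : z ∈ resolventSet ℂ M) :
    z ∈ resolventSet ℂ (perturb M lam u v) ↔ fredholmDet M lam u v z ≠ 0 := by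
  refine ⟨fun hρ hd => ?_, fun hd => (resolvent_perturb hz hd).1⟩
  obtain ⟨ψ, hψ0, hψ⟩ := (hasEigenvector_perturb_iff hz).2 hd
  have hu := (mem_resolventSet_iff' _ z).mp hρ
  have hinv := congrArg (fun T : H →L[ℂ] H => T ψ) (Ring.inverse_mul_cancel _ hu)
  simp only [mul_apply_eq_comp, sub_apply, smul_apply, one_apply_eq_self, ← hψ, sub_self,
    map_zero] at hinv
  exact hψ0 hinv.symm

/-- For `z ∈ ρ(M)`: `z ∈ σ(H_λ)` iff `det(1 − λ g(z)) = 0` iff `z` is an eigenvalue of `H_λ` — off the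
spectrum of the unperturbed operator the perturbed spectrum consists of eigenvalues located by the zeros of
the W–A determinant. [cite: Kato1966, Ch. IV §6.2 Thm 6.2] -/
theorem mem_spectrum_perturb_iff {M : H →L[ℂ] H} {lam : ℂ} {u v : ι → H} {z : ℂ}
    (hz : z ∈ resolventSet ℂ M) :
    z ∈ spectrum ℂ (perturb M lam u v) ↔ fredholmDet M lam u v z = 0 := by
  rw [spectrum, Set.mem_compl_iff, mem_resolventSet_perturb_iff hz, not_not]

/-- **Lippmann–Schwinger equation for the T-operator**: `T(z) = λS + λS (z − M)⁻¹ T(z)`,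
`S = Σ|u_i⟩⟨v_i|`, whenever `det(1 − λ g(z)) ≠ 0` (no `z ∈ ρ(M)` needed for the algebra).
[cite: DreizlerKirchnerLudde2018, §7.5 before eq. (7.30)] -/
theorem tOperator_lippmannSchwinger {M : H →L[ℂ] H} {lam : ℂ} {u v : ι → H} {z : ℂ}
    (hd : fredholmDet M lam u v z ≠ 0) :
    tOperator M lam u v z =
      lam • separableOp u v + (lam • separableOp u v) ∘L resolvent M z ∘L tOperator M lam u v z := by
  ext x
  simp only [add_apply, smul_apply, ContinuousLinearMap.comp_apply, tOperator_apply, separableOp_apply,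
    map_smul, coeffs_resolvent_synth]
  have h := tMatrix_mulVec_sub hd (coeffs v x)
  rw [sub_eq_iff_eq_add] at h
  conv_lhs => rw [h]
  rw [synth_add, synth_smul, smul_add]

/-! ## §5. Rank one -/

/-- The RANK-ONE perturbation `M + λ|u⟩⟨v|` (the `ι = Unit` instance of `perturb`).
[cite: Economou1983, §6.1 eqs. (6.1)–(6.3)] -/
def perturb₁ (M : H →L[ℂ] H) (lam : ℂ) (u v : H) : H →L[ℂ] H :=
  perturb M lam (fun _ : Unit => u) (fun _ : Unit => v)

/-- `(M + λ|u⟩⟨v|) x = M x + λ⟪v, x⟫u`. [folklore] -/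
theorem perturb₁_apply (M : H →L[ℂ] H) (lam : ℂ) (u v x : H) :
    perturb₁ M lam u v x = M x + lam • ⟪v, x⟫_ℂ • u := by
  simp [perturb₁, perturb_apply, synth, coeffs]

/-- The rank-one W–A determinant is `1 − λ⟪v, (z − M)⁻¹u⟫`. [cite: Economou1983, §6.1 eq. (6.9)] -/
theorem fredholmDet_unit (M : H →L[ℂ] H) (lam : ℂ) (u v : H) (z : ℂ) :
    fredholmDet M lam (fun _ : Unit => u) (fun _ : Unit => v) z = 1 - lam * ⟪v, resolvent M z u⟫_ℂ := by
  simp [fredholmDet, Matrix.det_unique]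

/-- **Rank one**: for `z ∈ ρ(M)`, `z` is an eigenvalue of `M + λ|u⟩⟨v|` iff `λ⟪v, (z − M)⁻¹u⟫ = 1`
(Economou's pole condition `G₀(ℓ,ℓ;E_p) = 1/ε`). [cite: Economou1983, §6.1 eq. (6.9)] -/
theorem hasEigenvector_perturb₁_iff {M : H →L[ℂ] H} {lam : ℂ} {u v : H} {z : ℂ}
    (hz : z ∈ resolventSet ℂ M) :
    (∃ ψ : H, ψ ≠ 0 ∧ perturb₁ M lam u v ψ = z • ψ) ↔ lam * ⟪v, resolvent M z u⟫_ℂ = 1 := by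
  rw [perturb₁, hasEigenvector_perturb_iff hz, fredholmDet_unit, sub_eq_zero, eq_comm]

/-! ## §6. Several channels: channel T-operators and Faddeev's resummation -/

section Faddeev

variable {α : Type*} [Fintype α] [DecidableEq α]

/-- **Channel T-operator (Lippmann–Schwinger equation of channel `a` in the full space)**: `t` is a channel
T-operator of the channel interaction `λV_a` at `z` for the free operator `H₀` iff
`t = λV_a + λV_a (z − H₀)⁻¹ t`. For a separable `V_a` the explicit `tOperator` of §2 qualifies
(`tOperator_lippmannSchwinger`). [cite: DreizlerKirchnerLudde2018, §7.5 before eq. (7.30)] -/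
def IsChannelTOperator (H₀ : H →L[ℂ] H) (lam : ℂ) (V : H →L[ℂ] H) (z : ℂ) (t : H →L[ℂ] H) : Prop :=
  t = lam • V + (lam • V) ∘L resolvent H₀ z ∘L t

/-- **THE FADDEEV SYSTEM.** For `H = H₀ + λ Σ_a V_a` with channel T-operators `t_a` at `z`, a family
`F = (F_a)` of operators SOLVES THE FADDEEV SYSTEM iff `F_a = t_a + t_a (z − H₀)⁻¹ Σ_{b ≠ a} F_b` for
every channel `a` (the pair interaction of each channel summed to all orders first; no consecutive
repetition of a channel). [cite: Faddeev1961] [cite: DreizlerKirchnerLudde2018, §7.5 eqs. (7.31)–(7.37)] -/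
def IsFaddeevSolution (H₀ : H →L[ℂ] H) (t : α → H →L[ℂ] H) (z : ℂ) (F : α → H →L[ℂ] H) : Prop :=
  ∀ a, F a = t a + t a ∘L resolvent H₀ z ∘L ∑ b ∈ Finset.univ.erase a, F b

/-- Each Faddeev component is the channel's share of the full T-operator:
`F_a = λV_a + λV_a R₀ T`, `T = Σ_b F_b`. [cite: DreizlerKirchnerLudde2018, §7.5 eqs. (7.34)–(7.36)] -/
theorem IsFaddeevSolution.component_eq {H₀ : H →L[ℂ] H} {lam : ℂ} {V : α → H →L[ℂ] H} {z : ℂ}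
    {t F : α → H →L[ℂ] H} (ht : ∀ a, IsChannelTOperator H₀ lam (V a) z (t a))
    (hF : IsFaddeevSolution H₀ t z F) (a : α) :
    F a = lam • V a + (lam • V a) ∘L resolvent H₀ z ∘L ∑ b, F b := by
  set R := resolvent H₀ z with hR
  set S := ∑ b ∈ Finset.univ.erase a, F b with hS
  have hsum : ∑ b, F b = F a + S := by
    rw [hS, Finset.add_sum_erase _ _ (Finset.mem_univ a)]
  have hFa : F a = t a + t a ∘L R ∘L S := hF a
  have hta : t a = lam • V a + (lam • V a) ∘L R ∘L t a := ht a
  rw [hsum]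
  ext x
  -- pointwise: F_a x = t_a x + t_a R S x, t_a y = λV_a y + λV_a R t_a y (at y = x and y = R S x)
  have e1 : F a x = t a x + t a (R (S x)) := by
    conv_lhs => rw [hFa]
    rw [add_apply, ContinuousLinearMap.comp_apply, ContinuousLinearMap.comp_apply]
  have e2 : ∀ y : H, t a y = (lam • V a) y + (lam • V a) (R (t a y)) := fun y => by
    conv_lhs => rw [hta]
    rw [add_apply, ContinuousLinearMap.comp_apply, ContinuousLinearMap.comp_apply]
  have e3 := e2 x
  have e4 := e2 (R (S x))
  simp only [add_apply, ContinuousLinearMap.comp_apply, map_add]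
  rw [e1, map_add, map_add]
  linear_combination (norm := module) e3 + e4

/-- **Faddeev's resummation ⇒ Lippmann–Schwinger.** If `F` solves the Faddeev system then the resummed
operator `T = Σ_a F_a` satisfies the full Lippmann–Schwinger equation `T = λV + λV (z − H₀)⁻¹ T`,
`V = Σ_a V_a`. [cite: Faddeev1961] [cite: DreizlerKirchnerLudde2018, §7.5 eqs. (7.25), (7.34)] -/
theorem IsFaddeevSolution.lippmannSchwinger {H₀ : H →L[ℂ] H} {lam : ℂ} {V : α → H →L[ℂ] H} {z : ℂ}
    {t F : α → H →L[ℂ] H} (ht : ∀ a, IsChannelTOperator H₀ lam (V a) z (t a))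
    (hF : IsFaddeevSolution H₀ t z F) :
    ∑ a, F a = lam • ∑ a, V a + (lam • ∑ a, V a) ∘L resolvent H₀ z ∘L ∑ a, F a := by
  conv_lhs => rw [show ∑ a, F a = ∑ a, (lam • V a + (lam • V a) ∘L resolvent H₀ z ∘L ∑ b, F b) from
    Finset.sum_congr rfl fun a _ => hF.component_eq ht a]
  ext x
  simp only [sum_apply, add_apply, smul_apply, ContinuousLinearMap.comp_apply, Finset.sum_add_distrib,
    Finset.smul_sum]

/-- **Faddeev's resummation inverts `z − H`.** If `z ∈ ρ(H₀)` and `F` solves the Faddeev system for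
`H = H₀ + λΣ_a V_a`, then `R := R₀ + R₀ T R₀`, `T = Σ_a F_a`, `R₀ = (z − H₀)⁻¹`, is a right inverse of
`z − H`: `(z − H) R = 1`. (For self-adjoint `H` and `z ∉ ℝ`, or whenever `z − H` is known injective, `R`
is THE resolvent.) [cite: Faddeev1961] [cite: DreizlerKirchnerLudde2018, §7.5] -/
theorem IsFaddeevSolution.rightInverse {H₀ : H →L[ℂ] H} {lam : ℂ} {V : α → H →L[ℂ] H} {z : ℂ}
    {t F : α → H →L[ℂ] H} (hz : z ∈ resolventSet ℂ H₀)
    (ht : ∀ a, IsChannelTOperator H₀ lam (V a) z (t a)) (hF : IsFaddeevSolution H₀ t z F) :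
    (z • (1 : H →L[ℂ] H) - (H₀ + lam • ∑ a, V a)) *
        (resolvent H₀ z + resolvent H₀ z ∘L (∑ a, F a) ∘L resolvent H₀ z) = 1 := by
  set R := resolvent H₀ z with hR
  set T := ∑ a, F a with hT
  set W := lam • ∑ a, V a with hW
  have hLS : T = W + W ∘L R ∘L T := hF.lippmannSchwinger ht
  refine ContinuousLinearMap.ext fun x => ?_
  have h1 : z • R x - H₀ (R x) = x := sub_resolvent_apply hz x
  have h2 : z • R (T (R x)) - H₀ (R (T (R x))) = T (R x) := sub_resolvent_apply hz _
  have h3 : T (R x) = W (R x) + W (R (T (R x))) := by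
    have := congrArg (fun A : H →L[ℂ] H => A (R x)) hLS
    simpa only [add_apply, ContinuousLinearMap.comp_apply] using this
  simp only [mul_apply_eq_comp, one_apply_eq_self, sub_apply, add_apply, smul_apply,
    ContinuousLinearMap.comp_apply, map_add]
  linear_combination (norm := module) h1 + h2 + h3

end Faddeev

end FiniteRank

end Literature.MathematicalPhysics.KineticTheory
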